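import Summits.ValiantsHypothesis.ValiantsHypothesis.Theorems.LacunarySymmetroidMatrixDescartesCensusV19CSoundSharp

/-!
# `MatrixDescartes` census — soundness of the CASE-C checker: a nineteen yields a model in its cell; `V19C.posRootLawOn_of_checkSupport`, `V19C.posRootLawOn_of_tableOK`

HONEST FRAMING.  Object-search cell `pub-symmetroid`; door-A item `DoorA26 = PosRootLawAt 2 6 19`
(stmt-ValiantsHypothesis-19979; OPEN, typed, never asserted).  Conclusion of the proof that certificates accepted by `V19C.checkSupport` (`…CensusV19CCheck`)
exclude a nineteen — `19` distinct positive det-roots of a six-term real symmetric `2 × 2` pencil — on a one-collision support: such a pencil realises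
one of the twelve cells (orientation = sign of its lowest coefficient; branch of `c⋆ = G_A + G_B` by `Census.caseC_dispatch`, val-sym-door-p5 g3's
…CaseCKit) and supplies a `V19C.Model` there, which the cell's accepted certificate refutes (`V19C.certOK_sound`).  Hence every key of an accepted
table satisfies `PosRootLawOn 2 6 18`.  Nothing here bears on the `2`-Sidon supports, on `ζ_sym(2,6)` over all supports, on `DoorA26` itself, on
`MatrixDescartes` (stmt-ValiantsHypothesis-18050) or on `VP ≠ VNP`.

[folklore] Certificate-checker soundness; elementary.
-/

-- the D-0017 layout repeats a namespace component (single-conjunct summit); the `dupNamespace` linter flags it; name mandated.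
set_option linter.dupNamespace false

namespace Summit.ValiantsHypothesis.ValiantsHypothesis.Theorems.LacunarySymmetroidMatrixDescartes.Census.V19C

open V20 (Atom allAtoms psum posOf qA cA Term PolySpec posl FNat fval Row rowC25 FRat negAt sgnR tval pval lprod aval qv bv pdet dfun
  fin6 lprod_cons lprod_nil fval_nil fval_singleton qA_mem cA_mem fin6_eq aval_qA aval_cA pval_G3 pval_RCS pval_W tri_pos)
open Summit.ValiantsHypothesis.ValiantsHypothesis.Theorems.MatrixDescartes.Negative (PosRootLawAt)

section Nineteen

open Polynomial Finset
open scoped BigOperators Polynomial Matrix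

variable {dl : List ℕ} {ord : List Atom} {pstar : ℕ} {S : Fin 6 → Matrix (Fin 2) (Fin 2) ℝ}

/-! ### LINK rows from the branch inequalities -/

/-- The LINK rows licensed by a branch hold once the branch's magnitude inequalities hold for the slots `p⋆, 20, 21`. [folklore] -/
theorem link_holds {br : Br} {x : ℕ → ℝ} {pstar : ℕ}
    (hZA : br = .ZA → x pstar ≤ x 21 ∧ x 21 ≤ x pstar)
    (hZB : br = .ZB → x pstar ≤ x 20 ∧ x 20 ≤ x pstar)
    (hPPa : br = .PPa → x 21 ≤ x 20 ∧ x 20 ≤ x pstar ∧ x pstar ≤ 2 * x 20)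
    (hPPb : br = .PPb → x 20 ≤ x 21 ∧ x 21 ≤ x pstar ∧ x pstar ≤ 2 * x 21)
    (hPM : br = .PM → x 21 ≤ x 20 ∧ x pstar ≤ x 20)
    (hMP : br = .MP → x 20 ≤ x 21 ∧ x pstar ≤ x 21) :
    ∀ sm f lg, linkOK br sm f lg = true → (rowLink pstar sm f lg).Holds x := by
  intro sm f lg hl
  unfold Row.Holds rowLink
  simp only [lprod_cons, lprod_nil, fval_nil, fval_singleton, pow_one, mul_one, Nat.cast_one, LinkVar.slot]
  cases br <;> cases sm <;> cases lg <;> simp [linkOK] at hl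
  all_goals first
    | (obtain ⟨h1, h2⟩ := hZA rfl; rw [hl]; push_cast; linarith)
    | (obtain ⟨h1, h2⟩ := hZB rfl; rw [hl]; push_cast; linarith)
    | (obtain ⟨h1, h2, h3⟩ := hPPa rfl; rw [hl]; push_cast; linarith)
    | (obtain ⟨h1, h2, h3⟩ := hPPb rfl; rw [hl]; push_cast; linarith)
    | (obtain ⟨h1, h2⟩ := hPM rfl; rw [hl]; push_cast; linarith)
    | (obtain ⟨h1, h2⟩ := hMP rfl; rw [hl]; push_cast; linarith)

/-! ### The atom valuation of a nineteen in its cell -/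

/-- The valuation field of the model: every atom is its slot's real sign times its slot's magnitude, given this for `A` and `B`. [folklore] -/
theorem hv_of_nineteen (h : ordOK dl ord pstar = true) (hS : ∀ l, (S l).IsSymm)
    (h19 : 19 ≤ ((pdet dl S).roots.toFinset.filter (fun t => 0 < t)).card) (br : Br) (x : ℕ → ℝ)
    (hx : ∀ t, t < 20 → x t = |(pdet dl S).coeff (((ord.eraseIdx (pstar + 1)).map (psum dl)).getD t 0)|)
    (hA : aval S (ord.getD pstar (0, 0))
      = sgR (mkCtx dl ord pstar (decide (0 < (pdet dl S).coeff (((ord.eraseIdx (pstar + 1)).map (psum dl)).getD 0 0))) br) 20 * x 20)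
    (hB : aval S (ord.getD (pstar + 1) (0, 0))
      = sgR (mkCtx dl ord pstar (decide (0 < (pdet dl S).coeff (((ord.eraseIdx (pstar + 1)).map (psum dl)).getD 0 0))) br) 21 * x 21) :
    ∀ a ∈ allAtoms, aval S a
      = sgR (mkCtx dl ord pstar (decide (0 < (pdet dl S).coeff (((ord.eraseIdx (pstar + 1)).map (psum dl)).getD 0 0))) br)
          ((mkCtx dl ord pstar (decide (0 < (pdet dl S).coeff (((ord.eraseIdx (pstar + 1)).map (psum dl)).getD 0 0))) br).slot a)
        * x ((mkCtx dl ord pstar (decide (0 < (pdet dl S).coeff (((ord.eraseIdx (pstar + 1)).map (psum dl)).getD 0 0))) br).slot a) := by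
  intro a ha
  rcases atom_cases h ha with rfl | rfl | ⟨t, ht, htp, rfl⟩
  · rw [slot_A h]; exact hA
  · rw [slot_B h]; exact hB
  · rw [slot_of_o20 h ht htp, sgR_lt_20 ht, hx t ht, ← coeff_E_of_ne h hS ht htp]
    exact coeff_eq_sgnR_mul_abs h h19 ht

/-! ### The null-letter triangle in entries -/

/-- No odd triangle through a null letter: in entries, from `polarDet_triangle_pos_of_null`. [folklore] -/
theorem triNull_aval (S : Fin 6 → Matrix (Fin 2) (Fin 2) ℝ) {n a b : ℕ} (hna : n ≠ a) (hab : a ≠ b) (hnb : n ≠ b)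
    (hn : aval S (qA n) = 0) (ha : 0 < aval S (qA a)) (hb : 0 < aval S (qA b)) (hne : aval S (cA n b) ≠ 0) :
    0 < aval S (cA n a) * aval S (cA a b) * aval S (cA n b) := by
  rw [aval_qA] at hn ha hb
  rw [aval_cA S hna, aval_cA S hab, aval_cA S hnb] at *
  unfold qv at hn ha hb
  unfold bv at hne ⊢
  exact polarDet_triangle_pos_of_null _ _ _ _ _ _ _ _ _ hn ha hb hne

/-! ### The model -/

/-- **A nineteen yields a model**: a pencil with `19` distinct positive det-roots on a support passing `V19C.ordOK` supplies a `V19C.Model` in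
the cell of its orientation and of the branch of `c⋆ = G_A + G_B` it realises. [folklore] -/
theorem model_of_nineteen (h : ordOK dl ord pstar = true) (hS : ∀ l, (S l).IsSymm)
    (h19 : 19 ≤ ((pdet dl S).roots.toFinset.filter (fun t => 0 < t)).card) :
    ∃ br x, Model (mkCtx dl ord pstar (decide (0 < (pdet dl S).coeff (((ord.eraseIdx (pstar + 1)).map (psum dl)).getD 0 0))) br)
      x (aval S) := by
  have hp20 : pstar < 20 := by have := (ordOK_spec h).2.2.2.2.1; omega
  have hcs := coeff_E_pstar h hS
  have hmem : ((ord.eraseIdx (pstar + 1)).map (psum dl)).getD pstar 0 ∈ ((ord.eraseIdx (pstar + 1)).map (psum dl)).toFinset := by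
    rw [List.mem_toFinset, List.getD_eq_getElem _ _ (by rw [length_E h]; exact hp20)]; exact List.getElem_mem _
  obtain ⟨-, hc0, hbr⟩ := caseC_dispatch (pdet dl S) _ (card_E h) (support_subset_E h S) h19 hmem hcs
  -- the sign of `c⋆`
  have hσ := sgnR_cases (decide (0 < (pdet dl S).coeff (((ord.eraseIdx (pstar + 1)).map (psum dl)).getD 0 0))) pstar
  have hσc := sign_pattern h h19 pstar hp20
  have hcabs := coeff_eq_sgnR_mul_abs h h19 hp20
  -- the slot magnitudes
  let x : ℕ → ℝ := fun k => if k < 20 then |(pdet dl S).coeff (((ord.eraseIdx (pstar + 1)).map (psum dl)).getD k 0)|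
    else if k = 20 then (if aval S (ord.getD pstar (0, 0)) = 0 then 1 else |aval S (ord.getD pstar (0, 0))|)
    else if k = 21 then (if aval S (ord.getD (pstar + 1) (0, 0)) = 0 then 1 else |aval S (ord.getD (pstar + 1) (0, 0))|)
    else 1
  have hx : ∀ t, t < 20 → x t = |(pdet dl S).coeff (((ord.eraseIdx (pstar + 1)).map (psum dl)).getD t 0)| := by
    intro t ht; simp [x, ht]
  have hxp : x pstar = |(pdet dl S).coeff (((ord.eraseIdx (pstar + 1)).map (psum dl)).getD pstar 0)| := hx pstar hp20
  have hx20 : ∀ {g : ℝ}, aval S (ord.getD pstar (0, 0)) = g → g ≠ 0 → x 20 = |g| := by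
    intro g hg hg0; simp only [x, hg, hg0, lt_self_iff_false, if_false, if_true]
  have hx21 : ∀ {g : ℝ}, aval S (ord.getD (pstar + 1) (0, 0)) = g → g ≠ 0 → x 21 = |g| := by
    intro g hg hg0
    simp only [x, hg, hg0, show ¬ (21:ℕ) < 20 by norm_num, show (21:ℕ) ≠ 20 by norm_num, if_false, if_true]
  have xpos : ∀ t, 0 < x t := by
    intro t
    by_cases ht : t < 20
    · rw [hx t ht]; exact abs_pos.2 (coeff_E_ne_zero h h19 ht)
    · simp only [x, if_neg ht]
      split_ifs <;> first | exact one_pos | exact abs_pos.2 ‹_›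
  -- the fields that do not depend on the branch
  have c25 : ∀ br, ∀ t, 1 ≤ t → t ≤ 18 →
      (rowC25 (mkCtx dl ord pstar (decide (0 < (pdet dl S).coeff (((ord.eraseIdx (pstar + 1)).map (psum dl)).getD 0 0))) br).E t).Holds x :=
    fun br t h1 h18 => rowC25_of_nineteen h h19 x hx h1 h18
  have g3 : ∀ i j k, i < j → j < k → k < 6 → 0 ≤ pval (aval S) (V20.G3poly i j k) := fun i j k hij hjk _ => pval_G3 S hij hjk
  have rcs : ∀ i j, i < 6 → j < 6 → i ≠ j → 0 < aval S (qA i) → 0 ≤ pval (aval S) (V20.RCSpoly i j) :=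
    fun i j _ _ hij hq => pval_RCS S hij hq
  have w : ∀ i j k l, i < 6 → j < 6 → k < 6 → l < 6 → i ≠ j → i ≠ k → i ≠ l → j ≠ k → j ≠ l → k < l →
      0 ≤ pval (aval S) (V20.Wpoly i j k l) := fun i j k l _ _ _ _ hij hik hil hjk hjl hkl => pval_W S hij hik hil hjk hjl hkl
  have tri : ∀ i j k, i < j → j < k → k < 6 → 0 < aval S (qA i) → 0 < aval S (qA j) → 0 < aval S (qA k) →
      0 < aval S (cA i j) * aval S (cA j k) * aval S (cA i k) := fun i j k hij hjk _ hi hj hk => tri_pos S hij hjk hi hj hk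
  have triN : ∀ n a b, n < 6 → a < b → b < 6 → n ≠ a → n ≠ b → aval S (qA n) = 0 → 0 < aval S (qA a) → 0 < aval S (qA b) →
      aval S (cA n b) ≠ 0 → 0 < aval S (cA n a) * aval S (cA a b) * aval S (cA n b) :=
    fun n a b _ hab _ hna hnb hn ha hb hne => triNull_aval S hna hab.ne hnb hn ha hb hne
  -- abbreviations for the three players
  set gA := aval S (ord.getD pstar (0, 0)) with hgA
  set gB := aval S (ord.getD (pstar + 1) (0, 0)) with hgB
  set c := (pdet dl S).coeff (((ord.eraseIdx (pstar + 1)).map (psum dl)).getD pstar 0) with hc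
  set σ := sgnR (decide (0 < (pdet dl S).coeff (((ord.eraseIdx (pstar + 1)).map (psum dl)).getD 0 0))) pstar with hσdef
  rcases hbr with ⟨hA0, hBc⟩ | ⟨hB0, hAc⟩ | ⟨hA, hB, h1, h2, h3⟩ | ⟨hA, hB, h1, h2, h3⟩ | ⟨hA, hB, h1, h2⟩ | ⟨hA, hB, h1, h2⟩
  · -- ZA : `G_A = 0`, `G_B = c⋆`
    have e21 : x 21 = |c| := by rw [hx21 rfl (by rw [hBc]; exact hc0), hBc]
    refine ⟨.ZA, x, ⟨mkCtx_wf h, xpos, ?_, c25 _, ?_, g3, rcs, w, tri, triN⟩⟩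
    · refine hv_of_nineteen h hS h19 .ZA x hx ?_ ?_
      · rw [sgR_20, if_pos rfl, zero_mul]; exact hA0
      · rw [sgR_21, if_neg (by decide), if_neg (by decide), e21, ← hgB, hBc]; exact hcabs
    · show ∀ sm f lg, linkOK Br.ZA sm f lg = true → (rowLink pstar sm f lg).Holds x
      exact link_holds (fun _ => ⟨by rw [hxp, e21], by rw [hxp, e21]⟩) (fun h => Br.noConfusion h) (fun h => Br.noConfusion h)
        (fun h => Br.noConfusion h) (fun h => Br.noConfusion h) (fun h => Br.noConfusion h)
  · -- ZB : `G_B = 0`, `G_A = c⋆`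
    have e20 : x 20 = |c| := by rw [hx20 rfl (by rw [hAc]; exact hc0), hAc]
    refine ⟨.ZB, x, ⟨mkCtx_wf h, xpos, ?_, c25 _, ?_, g3, rcs, w, tri, triN⟩⟩
    · refine hv_of_nineteen h hS h19 .ZB x hx ?_ ?_
      · rw [sgR_20, if_neg (by decide), if_neg (by decide), e20, ← hgA, hAc]; exact hcabs
      · rw [sgR_21, if_pos rfl, zero_mul]; exact hB0
    · show ∀ sm f lg, linkOK Br.ZB sm f lg = true → (rowLink pstar sm f lg).Holds x
      exact link_holds (fun h => Br.noConfusion h) (fun _ => ⟨by rw [hxp, e20], by rw [hxp, e20]⟩) (fun h => Br.noConfusion h)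
        (fun h => Br.noConfusion h) (fun h => Br.noConfusion h) (fun h => Br.noConfusion h)
  · -- PPa
    have hA0 : gA ≠ 0 := by rintro h0; rw [h0, zero_mul] at hA; exact lt_irrefl _ hA
    have hB0 : gB ≠ 0 := by rintro h0; rw [h0, zero_mul] at hB; exact lt_irrefl _ hB
    have e20 : x 20 = |gA| := hx20 rfl hA0
    have e21 : x 21 = |gB| := hx21 rfl hB0
    refine ⟨.PPa, x, ⟨mkCtx_wf h, xpos, ?_, c25 _, ?_, g3, rcs, w, tri, triN⟩⟩
    · refine hv_of_nineteen h hS h19 .PPa x hx ?_ ?_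
      · rw [sgR_20, if_neg (by decide), if_neg (by decide), e20]; exact eq_sgn_mul_abs_of_same hσ hσc hA
      · rw [sgR_21, if_neg (by decide), if_neg (by decide), e21]; exact eq_sgn_mul_abs_of_same hσ hσc hB
    · show ∀ sm f lg, linkOK Br.PPa sm f lg = true → (rowLink pstar sm f lg).Holds x
      exact link_holds (fun h => Br.noConfusion h) (fun h => Br.noConfusion h)
        (fun _ => ⟨by rw [e20, e21]; exact h1, by rw [e20, hxp]; exact h2.le, by rw [hxp, e20]; exact h3⟩)
        (fun h => Br.noConfusion h) (fun h => Br.noConfusion h) (fun h => Br.noConfusion h)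
  · -- PPb
    have hA0 : gA ≠ 0 := by rintro h0; rw [h0, zero_mul] at hA; exact lt_irrefl _ hA
    have hB0 : gB ≠ 0 := by rintro h0; rw [h0, zero_mul] at hB; exact lt_irrefl _ hB
    have e20 : x 20 = |gA| := hx20 rfl hA0
    have e21 : x 21 = |gB| := hx21 rfl hB0
    refine ⟨.PPb, x, ⟨mkCtx_wf h, xpos, ?_, c25 _, ?_, g3, rcs, w, tri, triN⟩⟩
    · refine hv_of_nineteen h hS h19 .PPb x hx ?_ ?_
      · rw [sgR_20, if_neg (by decide), if_neg (by decide), e20]; exact eq_sgn_mul_abs_of_same hσ hσc hA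
      · rw [sgR_21, if_neg (by decide), if_neg (by decide), e21]; exact eq_sgn_mul_abs_of_same hσ hσc hB
    · show ∀ sm f lg, linkOK Br.PPb sm f lg = true → (rowLink pstar sm f lg).Holds x
      exact link_holds (fun h => Br.noConfusion h) (fun h => Br.noConfusion h) (fun h => Br.noConfusion h)
        (fun _ => ⟨by rw [e20, e21]; exact h1, by rw [e21, hxp]; exact h2.le, by rw [hxp, e21]; exact h3⟩)
        (fun h => Br.noConfusion h) (fun h => Br.noConfusion h)
  · -- PM
    have hA0 : gA ≠ 0 := by rintro h0; rw [h0, zero_mul] at hA; exact lt_irrefl _ hA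
    have hB0 : gB ≠ 0 := by rintro h0; rw [h0, zero_mul] at hB; exact lt_irrefl _ hB
    have e20 : x 20 = |gA| := hx20 rfl hA0
    have e21 : x 21 = |gB| := hx21 rfl hB0
    refine ⟨.PM, x, ⟨mkCtx_wf h, xpos, ?_, c25 _, ?_, g3, rcs, w, tri, triN⟩⟩
    · refine hv_of_nineteen h hS h19 .PM x hx ?_ ?_
      · rw [sgR_20, if_neg (by decide), if_neg (by decide), e20]; exact eq_sgn_mul_abs_of_same hσ hσc hA
      · rw [sgR_21, if_neg (by decide), if_pos rfl, e21]; exact eq_neg_sgn_mul_abs_of_opp hσ hσc hB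
    · show ∀ sm f lg, linkOK Br.PM sm f lg = true → (rowLink pstar sm f lg).Holds x
      exact link_holds (fun h => Br.noConfusion h) (fun h => Br.noConfusion h) (fun h => Br.noConfusion h)
        (fun h => Br.noConfusion h) (fun _ => ⟨by rw [e20, e21]; exact h1.le, by rw [hxp, e20]; exact h2.le⟩)
        (fun h => Br.noConfusion h)
  · -- MP
    have hA0 : gA ≠ 0 := by rintro h0; rw [h0, zero_mul] at hA; exact lt_irrefl _ hA
    have hB0 : gB ≠ 0 := by rintro h0; rw [h0, zero_mul] at hB; exact lt_irrefl _ hB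
    have e20 : x 20 = |gA| := hx20 rfl hA0
    have e21 : x 21 = |gB| := hx21 rfl hB0
    refine ⟨.MP, x, ⟨mkCtx_wf h, xpos, ?_, c25 _, ?_, g3, rcs, w, tri, triN⟩⟩
    · refine hv_of_nineteen h hS h19 .MP x hx ?_ ?_
      · rw [sgR_20, if_neg (by decide), if_pos rfl, e20]; exact eq_neg_sgn_mul_abs_of_opp hσ hσc hA
      · rw [sgR_21, if_neg (by decide), if_neg (by decide), e21]; exact eq_sgn_mul_abs_of_same hσ hσc hB
    · show ∀ sm f lg, linkOK Br.MP sm f lg = true → (rowLink pstar sm f lg).Holds x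
      exact link_holds (fun h => Br.noConfusion h) (fun h => Br.noConfusion h) (fun h => Br.noConfusion h)
        (fun h => Br.noConfusion h) (fun h => Br.noConfusion h)
        (fun _ => ⟨by rw [e20, e21]; exact h1.le, by rw [hxp, e21]; exact h2.le⟩)

/-! ### The main theorems -/

/-- What `cellsOK` establishes: every listed cell carries an accepted certificate. [folklore] -/
theorem cellsOK_spec (d : List ℕ) (ord : List Atom) (pstar : ℕ) :
    ∀ (L : List (Bool × Br)) (cs : List Cert), cellsOK d ord pstar L cs = true →
      ∀ sb ∈ L, ∃ ct, certOK (mkCtx d ord pstar sb.1 sb.2) ct = true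
  | [], _, _, sb, hsb => by simp at hsb
  | (s, br) :: L, [], h, _, _ => by simp [cellsOK] at h
  | (s, br) :: L, ct :: cs, h, sb, hsb => by
    simp only [cellsOK, Bool.and_eq_true] at h
    rcases List.mem_cons.1 hsb with rfl | hsb
    · exact ⟨ct, h.1⟩
    · exact cellsOK_spec d ord pstar L cs h.2 sb hsb

/-- Every cell is listed. [folklore] -/
theorem mem_cells (s : Bool) (br : Br) : (s, br) ∈ cells := by
  cases s <;> cases br <;> decide

/-- **Soundness of the support checker**: a one-collision support whose twelve cells carry accepted certificates has no nineteen —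
`ζ(2,6; d) ≤ 18`. [folklore] -/
theorem posRootLawOn_of_checkSupport (dl : List ℕ) (certs : List Cert) (h : checkSupport dl certs = true) :
    PosRootLawOn 2 6 18 (fun i => dl.getD i 0) := by
  intro S hS
  by_contra hlt
  have h19 : 19 ≤ ((pdet dl S).roots.toFinset.filter (fun t => 0 < t)).card := by
    unfold pdet dfun; push Not at hlt; exact hlt
  unfold checkSupport at h
  simp only [Bool.and_eq_true] at h
  obtain ⟨hord, hcells⟩ := h
  obtain ⟨br, x, M⟩ := model_of_nineteen hord hS h19
  obtain ⟨ct, hct⟩ := cellsOK_spec dl _ _ cells certs hcells (_, br) (mem_cells _ br)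
  exact certOK_sound M hct

/-- **Soundness of the table checker**: every key of an accepted table satisfies `ζ(2,6; d) ≤ 18`. [folklore] -/
theorem posRootLawOn_of_tableOK (keys : List (List ℕ)) (T : List Line) (h : tableOK keys T = true) :
    ∀ d ∈ keys, PosRootLawOn 2 6 18 (fun i => d.getD i 0) := by
  unfold tableOK at h
  simp only [Bool.and_eq_true, decide_eq_true_eq, List.all_eq_true] at h
  obtain ⟨hkeys, hall⟩ := h
  intro d hd
  rw [← hkeys, List.mem_map] at hd
  obtain ⟨l, hl, rfl⟩ := hd
  exact posRootLawOn_of_checkSupport l.1 l.2 (hall l hl)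

end Nineteen

end Summit.ValiantsHypothesis.ValiantsHypothesis.Theorems.LacunarySymmetroidMatrixDescartes.Census.V19C
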